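import Summits.CriticalPhenomena.PercolationContinuityZ3.Theorems.PercNearOneGluingNoHeavyLowerTailCILOvertakingCells
import Summits.CriticalPhenomena.PercolationContinuityZ3.Theorems.PercNearOneGluingNoHeavyLowerTailCILOvertakingToolkit
import HarnessLib

/-!
# `NoHeavyLowerTail` (stmt-CriticalPhenomena-4575) — the four CELL BOUNDS of the overtaking bound (disjoint / empty / intersecting blocks)

Support file (prover `prim-hp-3`, hull-port line; `--supports stmt-CriticalPhenomena-4575`).  No definitions, no named facts, no sorries.
Step 4a of run/shared/lean/prim/prim-hp-3/PROOF-OVERTAKING-BOUND.md; the summation (the theorem `Hyperedge.overtaking_bound`) is in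
`…CILOvertakingBound.lean`.  In the vocabulary of the double star expansions (`Hyperedge.pairCSdiff_double_star_expansion`: separated cell `f(T,S)`;
`Hyperedge.lightness_double_star_expansion`: two-block lightness `c₂(v)`; block terms `ℓ_B = μ_K{1 ≤ |{z : ∃ u ∈ B, R₂ u z}| ≤ j}`), for every
weight `K`, relays `A ⊇ T, S`, vertices `i, x`, level `j`:

      `c₂(i) − c₂(x) − max 0 (max ℓ_T ℓ_S − c₂(x)) ≤ f(T,S)`

* `cell_bound_disjoint` (T, S nonempty and disjoint): `Hyperedge.overtaking_cell` (glue bridges + `HullPort.lightness_margin_glue_ge_max_any`, i.e.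
  ABSORPTION MONOTONICITY) + `sepMargin_eq_closure_sub_uniform` + root lemmas + `twoBlock_orient_iff` (the two expansions orient the closure differently);
* `cell_bound_empty_left` (`T = ∅`), `cell_bound_empty_right` (`S = ∅`), `cell_bound_meet` (`T ∩ S ≠ ∅`): no gluing — the two closures coincide.
-/

noncomputable section

namespace Summit.CriticalPhenomena.PercolationContinuityZ3.Theorems

open MeasureTheory Set Literature.Probability.LatticeModels Literature.Probability.Percolation
open scoped Classical BigOperators

variable {n : ℕ}

namespace Hyperedge

/-- Orientation: the two-block closure written with `R c v` (as in `lightness_double_star_expansion`) versus with `R v c` (as in `overtaking_cell`)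
agree for a symmetric relation. [folklore] -/
theorem twoBlock_orient_iff (R : Fin n → Fin n → Prop) (hsymm : ∀ a b, R a b → R b a) (T S : Finset (Fin n)) (v z : Fin n) :
    ((R v z ∨ ((∃ c ∈ T, R c v) ∧ ∃ c' ∈ T, R c' z)) ∨
        ((∃ s ∈ S, R s v ∨ ((∃ c ∈ T, R c s) ∧ ∃ c' ∈ T, R c' v)) ∧
          ∃ s' ∈ S, R s' z ∨ ((∃ c ∈ T, R c s') ∧ ∃ c' ∈ T, R c' z))) ↔
      ((R v z ∨ ((∃ t ∈ T, R v t) ∧ ∃ t ∈ T, R t z)) ∨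
        ((∃ s ∈ S, R v s ∨ ((∃ t ∈ T, R v t) ∧ ∃ t ∈ T, R t s)) ∧
          ∃ s ∈ S, R s z ∨ ((∃ t ∈ T, R s t) ∧ ∃ t ∈ T, R t z))) := by
  have hS : ∀ s, (R s v ∨ ((∃ c ∈ T, R c s) ∧ ∃ c' ∈ T, R c' v)) ↔ (R v s ∨ ((∃ t ∈ T, R v t) ∧ ∃ t ∈ T, R t s)) := by
    intro s
    constructor
    · rintro (h | ⟨⟨c, hc, hcs⟩, ⟨c', hc', hc'v⟩⟩)
      · exact Or.inl (hsymm _ _ h)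
      · exact Or.inr ⟨⟨c', hc', hsymm _ _ hc'v⟩, ⟨c, hc, hcs⟩⟩
    · rintro (h | ⟨⟨t, ht, hvt⟩, ⟨t', ht', ht's⟩⟩)
      · exact Or.inl (hsymm _ _ h)
      · exact Or.inr ⟨⟨t', ht', ht's⟩, ⟨t, ht, hsymm _ _ hvt⟩⟩
  have hS2 : ∀ s, (R s z ∨ ((∃ c ∈ T, R c s) ∧ ∃ c' ∈ T, R c' z)) ↔ (R s z ∨ ((∃ t ∈ T, R s t) ∧ ∃ t ∈ T, R t z)) := by
    intro s
    constructor
    · rintro (h | ⟨⟨c, hc, hcs⟩, ⟨c', hc', hc'z⟩⟩)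
      · exact Or.inl h
      · exact Or.inr ⟨⟨c, hc, hsymm _ _ hcs⟩, ⟨c', hc', hc'z⟩⟩
    · rintro (h | ⟨⟨t, ht, hst⟩, ⟨t', ht', ht'z⟩⟩)
      · exact Or.inl h
      · exact Or.inr ⟨⟨t, ht, hsymm _ _ hst⟩, ⟨t', ht', ht'z⟩⟩
  constructor
  · rintro ((h | ⟨⟨c, hc, hcv⟩, ⟨c', hc', hc'z⟩⟩) | ⟨⟨s, hs, hsv⟩, ⟨s', hs', hs'z⟩⟩)
    · exact Or.inl (Or.inl h)
    · exact Or.inl (Or.inr ⟨⟨c, hc, hsymm _ _ hcv⟩, ⟨c', hc', hc'z⟩⟩)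
    · exact Or.inr ⟨⟨s, hs, (hS s).1 hsv⟩, ⟨s', hs', (hS2 s').1 hs'z⟩⟩
  · rintro ((h | ⟨⟨t, ht, hvt⟩, ⟨t', ht', ht'z⟩⟩) | ⟨⟨s, hs, hvs⟩, ⟨s', hs', hs'z⟩⟩)
    · exact Or.inl (Or.inl h)
    · exact Or.inl (Or.inr ⟨⟨t, ht, hsymm _ _ hvt⟩, ⟨t', ht', ht'z⟩⟩)
    · exact Or.inr ⟨⟨s, hs, (hS s).2 hvs⟩, ⟨s', hs', (hS2 s').2 hs'z⟩⟩

/-- Root lemma for the S-block of the two-block closure: `(∃ s ∈ S, R₂ s z) ↔ R₂ rS z` for `rS ∈ S`, `R` reflexive and transitive. [folklore] -/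
theorem reachClosure_rootS_iff (R : Fin n → Fin n → Prop) (hrefl : ∀ a, R a a) (htrans : ∀ a b c, R a b → R b c → R a c)
    (T S : Finset (Fin n)) {rS : Fin n} (hrS : rS ∈ S) (z : Fin n) :
    (∃ s ∈ S, ((R s z ∨ ((∃ t ∈ T, R s t) ∧ ∃ t ∈ T, R t z)) ∨
        ((∃ s₁ ∈ S, R s s₁ ∨ ((∃ t ∈ T, R s t) ∧ ∃ t ∈ T, R t s₁)) ∧
          ∃ s₂ ∈ S, R s₂ z ∨ ((∃ t ∈ T, R s₂ t) ∧ ∃ t ∈ T, R t z)))) ↔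
      ((R rS z ∨ ((∃ t ∈ T, R rS t) ∧ ∃ t ∈ T, R t z)) ∨
        ((∃ s₁ ∈ S, R rS s₁ ∨ ((∃ t ∈ T, R rS t) ∧ ∃ t ∈ T, R t s₁)) ∧
          ∃ s₂ ∈ S, R s₂ z ∨ ((∃ t ∈ T, R s₂ t) ∧ ∃ t ∈ T, R t z))) := by
  set R₁ : Fin n → Fin n → Prop := fun a b => R a b ∨ ((∃ t ∈ T, R a t) ∧ ∃ t ∈ T, R t b) with hR₁
  have h1trans : ∀ a b c, R₁ a b → R₁ b c → R₁ a c := fun a b c hab hbc => reachClosure_transitive R htrans T a b c hab hbc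
  have hQtrans : ∀ a b c, (R₁ a b ∨ ((∃ s ∈ S, R₁ a s) ∧ ∃ s' ∈ S, R₁ s' b)) →
      (R₁ b c ∨ ((∃ s ∈ S, R₁ b s) ∧ ∃ s' ∈ S, R₁ s' c)) → (R₁ a c ∨ ((∃ s ∈ S, R₁ a s) ∧ ∃ s' ∈ S, R₁ s' c)) :=
    fun a b c hab hbc => reachClosure_transitive R₁ h1trans S a b c hab hbc
  constructor
  · rintro ⟨s, hs, hQ⟩
    have hrs : R₁ rS s ∨ ((∃ s₁ ∈ S, R₁ rS s₁) ∧ ∃ s₂ ∈ S, R₁ s₂ s) :=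
      Or.inr ⟨⟨rS, hrS, Or.inl (hrefl rS)⟩, ⟨s, hs, Or.inl (hrefl s)⟩⟩
    exact hQtrans rS s z hrs hQ
  · intro h
    exact ⟨rS, hrS, h⟩

/-- Root lemma for one block: `(∃ s ∈ B, R¹ s z) ↔ R¹ r z` for `r ∈ B`, `R¹ = R^B`, `R` reflexive and transitive. [folklore] -/
theorem reachClosure_rootOne_iff (R : Fin n → Fin n → Prop) (hrefl : ∀ a, R a a) (htrans : ∀ a b c, R a b → R b c → R a c)
    (B : Finset (Fin n)) {r : Fin n} (hr : r ∈ B) (z : Fin n) :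
    (∃ s ∈ B, (R s z ∨ ((∃ t ∈ B, R s t) ∧ ∃ t ∈ B, R t z))) ↔ (R r z ∨ ((∃ t ∈ B, R r t) ∧ ∃ t ∈ B, R t z)) := by
  constructor
  · rintro ⟨s, hs, h⟩
    have hrs : R r s ∨ ((∃ t ∈ B, R r t) ∧ ∃ t ∈ B, R t s) := Or.inr ⟨⟨r, hr, hrefl r⟩, ⟨s, hs, hrefl s⟩⟩
    exact reachClosure_transitive R htrans B r s z hrs h
  · intro h
    exact ⟨r, hr, h⟩

/-- **Main cell of the overtaking bound (disjoint nonempty blocks).**  In the vocabulary of the double star expansions (see the file header):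
`c₂(i) − c₂(x) − max 0 (max ℓ_T ℓ_S − c₂(x)) ≤ f`. [this file] -/
theorem cell_bound_disjoint (K : Sym2 (Fin n) → unitInterval) (A T S : Finset (Fin n)) (i x : Fin n) (j : ℕ)
    (hTA : T ⊆ A) (hSA : S ⊆ A) (hT : T.Nonempty) (hS : S.Nonempty) (hdisj : Disjoint T S) :
    (prodBernoulli K).real {ω : BondConfig (Fin n) | (A.filter fun z => (((openGraph ω).Reachable i z ∨ ((∃ c ∈ T, (openGraph ω).Reachable c i) ∧ ∃ c' ∈ T, (openGraph ω).Reachable c' z)) ∨ ((∃ s ∈ S, (openGraph ω).Reachable s i ∨ ((∃ c ∈ T, (openGraph ω).Reachable c s) ∧ ∃ c' ∈ T, (openGraph ω).Reachable c' i)) ∧ ∃ s' ∈ S, (openGraph ω).Reachable s' z ∨ ((∃ c ∈ T, (openGraph ω).Reachable c s') ∧ ∃ c' ∈ T, (openGraph ω).Reachable c' z)))).card ≤ j} -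
        (prodBernoulli K).real {ω : BondConfig (Fin n) | (A.filter fun z => (((openGraph ω).Reachable x z ∨ ((∃ c ∈ T, (openGraph ω).Reachable c x) ∧ ∃ c' ∈ T, (openGraph ω).Reachable c' z)) ∨ ((∃ s ∈ S, (openGraph ω).Reachable s x ∨ ((∃ c ∈ T, (openGraph ω).Reachable c s) ∧ ∃ c' ∈ T, (openGraph ω).Reachable c' x)) ∧ ∃ s' ∈ S, (openGraph ω).Reachable s' z ∨ ((∃ c ∈ T, (openGraph ω).Reachable c s') ∧ ∃ c' ∈ T, (openGraph ω).Reachable c' z)))).card ≤ j} -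
        max 0 (max ((prodBernoulli K).real {ω : BondConfig (Fin n) | 1 ≤ (A.filter fun z => ∃ u ∈ T, (((openGraph ω).Reachable u z ∨ ((∃ t ∈ T, (openGraph ω).Reachable u t) ∧ ∃ t ∈ T, (openGraph ω).Reachable t z)) ∨ ((∃ s ∈ S, (openGraph ω).Reachable u s ∨ ((∃ t ∈ T, (openGraph ω).Reachable u t) ∧ ∃ t ∈ T, (openGraph ω).Reachable t s)) ∧ ∃ s ∈ S, (openGraph ω).Reachable s z ∨ ((∃ t ∈ T, (openGraph ω).Reachable s t) ∧ ∃ t ∈ T, (openGraph ω).Reachable t z)))).card ∧ (A.filter fun z => ∃ u ∈ T, (((openGraph ω).Reachable u z ∨ ((∃ t ∈ T, (openGraph ω).Reachable u t) ∧ ∃ t ∈ T, (openGraph ω).Reachable t z)) ∨ ((∃ s ∈ S, (openGraph ω).Reachable u s ∨ ((∃ t ∈ T, (openGraph ω).Reachable u t) ∧ ∃ t ∈ T, (openGraph ω).Reachable t s)) ∧ ∃ s ∈ S, (openGraph ω).Reachable s z ∨ ((∃ t ∈ T, (openGraph ω).Reachable s t) ∧ ∃ t ∈ T, (openGraph ω).Reachable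 t z)))).card ≤ j})
            ((prodBernoulli K).real {ω : BondConfig (Fin n) | 1 ≤ (A.filter fun z => ∃ u ∈ S, (((openGraph ω).Reachable u z ∨ ((∃ t ∈ T, (openGraph ω).Reachable u t) ∧ ∃ t ∈ T, (openGraph ω).Reachable t z)) ∨ ((∃ s ∈ S, (openGraph ω).Reachable u s ∨ ((∃ t ∈ T, (openGraph ω).Reachable u t) ∧ ∃ t ∈ T, (openGraph ω).Reachable t s)) ∧ ∃ s ∈ S, (openGraph ω).Reachable s z ∨ ((∃ t ∈ T, (openGraph ω).Reachable s t) ∧ ∃ t ∈ T, (openGraph ω).Reachable t z)))).card ∧ (A.filter fun z => ∃ u ∈ S, (((openGraph ω).Reachable u z ∨ ((∃ t ∈ T, (openGraph ω).Reachable u t) ∧ ∃ t ∈ T, (openGraph ω).Reachable t z)) ∨ ((∃ s ∈ S, (openGraph ω).Reachable u s ∨ ((∃ t ∈ T, (openGraph ω).Reachable u t) ∧ ∃ t ∈ T, (openGraph ω).Reachable t s)) ∧ ∃ s ∈ S, (openGraph ω).Reachable s z ∨ ((∃ t ∈ T, (openGraph ω).Reachable s t) ∧ ∃ t ∈ T,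 (openGraph ω).Reachable t z)))).card ≤ j}) -
          (prodBernoulli K).real {ω : BondConfig (Fin n) | (A.filter fun z => (((openGraph ω).Reachable x z ∨ ((∃ c ∈ T, (openGraph ω).Reachable c x) ∧ ∃ c' ∈ T, (openGraph ω).Reachable c' z)) ∨ ((∃ s ∈ S, (openGraph ω).Reachable s x ∨ ((∃ c ∈ T, (openGraph ω).Reachable c s) ∧ ∃ c' ∈ T, (openGraph ω).Reachable c' x)) ∧ ∃ s' ∈ S, (openGraph ω).Reachable s' z ∨ ((∃ c ∈ T, (openGraph ω).Reachable c s') ∧ ∃ c' ∈ T, (openGraph ω).Reachable c' z)))).card ≤ j}) ≤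
      (prodBernoulli K).real {ω : BondConfig (Fin n) | (∀ y ∈ S ∪ T, ¬ (openGraph ω).Reachable i y) ∧ (A.filter fun z => (openGraph ω).Reachable i z).card ≤ j} -
        (prodBernoulli K).real {ω : BondConfig (Fin n) | (∀ y ∈ S ∪ T, ¬ (openGraph ω).Reachable i y) ∧ 1 ≤ (A.filter fun z => ∃ y ∈ S ∪ T, (openGraph ω).Reachable y z).card ∧ (A.filter fun z => ∃ y ∈ S ∪ T, (openGraph ω).Reachable y z).card ≤ j} := by
  obtain ⟨rT, hrT⟩ := hT
  obtain ⟨rS, hrS⟩ := hS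
  have hne : rT ≠ rS := fun h => Finset.disjoint_left.1 hdisj hrT (h ▸ hrS)
  have hsymm : ∀ (ω : BondConfig (Fin n)) (a b : Fin n), (openGraph ω).Reachable a b → (openGraph ω).Reachable b a :=
    fun ω a b h => h.symm
  have htr : ∀ (ω : BondConfig (Fin n)) (a b d : Fin n), (openGraph ω).Reachable a b → (openGraph ω).Reachable b d →
      (openGraph ω).Reachable a d := fun ω a b d h1 h2 => h1.trans h2
  -- the glued-pair cell inequality in closure form
  have cell := overtaking_cell K A T S hrT hrS hne i j
  -- the separated margin as closure lightnesses (block `T ∪ S`)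
  have hU : S ∪ T = T ∪ S := Finset.union_comm _ _
  have l1 := sepMargin_eq_closure_sub_uniform K A (T ∪ S) i j (Finset.union_subset hTA hSA)
  -- orientation: the Step-2 cells are the closure lightnesses of `overtaking_cell`
  have hor : ∀ v : Fin n, (prodBernoulli K).real {ω : BondConfig (Fin n) | (A.filter fun z => (((openGraph ω).Reachable v z ∨ ((∃ c ∈ T, (openGraph ω).Reachable c v) ∧ ∃ c' ∈ T, (openGraph ω).Reachable c' z)) ∨ ((∃ s ∈ S, (openGraph ω).Reachable s v ∨ ((∃ c ∈ T, (openGraph ω).Reachable c s) ∧ ∃ c' ∈ T, (openGraph ω).Reachable c' v)) ∧ ∃ s' ∈ S, (openGraph ω).Reachable s' z ∨ ((∃ c ∈ T, (openGraph ω).Reachable c s') ∧ ∃ c' ∈ T, (openGraph ω).Reachable c' z)))).card ≤ j} =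
      (prodBernoulli K).real {ω : BondConfig (Fin n) | (A.filter fun z => (((openGraph ω).Reachable v z ∨ ((∃ t ∈ T, (openGraph ω).Reachable v t) ∧ ∃ t ∈ T, (openGraph ω).Reachable t z)) ∨ ((∃ s ∈ S, (openGraph ω).Reachable v s ∨ ((∃ t ∈ T, (openGraph ω).Reachable v t) ∧ ∃ t ∈ T, (openGraph ω).Reachable t s)) ∧ ∃ s ∈ S, (openGraph ω).Reachable s z ∨ ((∃ t ∈ T, (openGraph ω).Reachable s t) ∧ ∃ t ∈ T, (openGraph ω).Reachable t z)))).card ≤ j} := by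
    intro v
    congr 1
    ext ω
    simp only [mem_setOf_eq]
    rw [Finset.filter_congr (fun z _ => twoBlock_orient_iff (fun a b => (openGraph ω).Reachable a b) (hsymm ω) T S v z)]
  -- block terms are root lightnesses
  have hLT : (prodBernoulli K).real {ω : BondConfig (Fin n) | 1 ≤ (A.filter fun z => ∃ u ∈ T, (((openGraph ω).Reachable u z ∨ ((∃ t ∈ T, (openGraph ω).Reachable u t) ∧ ∃ t ∈ T, (openGraph ω).Reachable t z)) ∨ ((∃ s ∈ S, (openGraph ω).Reachable u s ∨ ((∃ t ∈ T, (openGraph ω).Reachable u t) ∧ ∃ t ∈ T, (openGraph ω).Reachable t s)) ∧ ∃ s ∈ S, (openGraph ω).Reachable s z ∨ ((∃ t ∈ T, (openGraph ω).Reachable s t) ∧ ∃ t ∈ T, (openGraph ω).Reachable t z)))).card ∧ (A.filter fun z => ∃ u ∈ T, (((openGraph ω).Reachable u z ∨ ((∃ t ∈ T, (openGraph ω).Reachable u t) ∧ ∃ t ∈ T, (openGraph ω).Reachable t z)) ∨ ((∃ s ∈ S, (openGraph ω).Reachable u s ∨ ((∃ t ∈ T, (openGraph ω).Reachable u t) ∧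 ∃ t ∈ T, (openGraph ω).Reachable t s)) ∧ ∃ s ∈ S, (openGraph ω).Reachable s z ∨ ((∃ t ∈ T, (openGraph ω).Reachable s t) ∧ ∃ t ∈ T, (openGraph ω).Reachable t z)))).card ≤ j} =
      (prodBernoulli K).real {ω : BondConfig (Fin n) | (A.filter fun z => (((openGraph ω).Reachable rT z ∨ ((∃ t ∈ T, (openGraph ω).Reachable rT t) ∧ ∃ t ∈ T, (openGraph ω).Reachable t z)) ∨ ((∃ s ∈ S, (openGraph ω).Reachable rT s ∨ ((∃ t ∈ T, (openGraph ω).Reachable rT t) ∧ ∃ t ∈ T, (openGraph ω).Reachable t s)) ∧ ∃ s ∈ S, (openGraph ω).Reachable s z ∨ ((∃ t ∈ T, (openGraph ω).Reachable s t) ∧ ∃ t ∈ T, (openGraph ω).Reachable t z)))).card ≤ j} := by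
    congr 1
    ext ω
    simp only [mem_setOf_eq]
    rw [Finset.filter_congr (fun z _ => reachClosure_root_iff (fun a b => (openGraph ω).Reachable a b)
      (fun a => SimpleGraph.Reachable.refl a) (htr ω) T S hrT z)]
    constructor
    · rintro ⟨_, h⟩; exact h
    · intro h
      refine ⟨Finset.card_pos.2 ⟨rT, Finset.mem_filter.2 ⟨hTA hrT, Or.inl (Or.inl (SimpleGraph.Reachable.refl _))⟩⟩, h⟩
  have hLS : (prodBernoulli K).real {ω : BondConfig (Fin n) | 1 ≤ (A.filter fun z => ∃ u ∈ S, (((openGraph ω).Reachable u z ∨ ((∃ t ∈ T, (openGraph ω).Reachable u t) ∧ ∃ t ∈ T, (openGraph ω).Reachable t z)) ∨ ((∃ s ∈ S, (openGraph ω).Reachable u s ∨ ((∃ t ∈ T, (openGraph ω).Reachable u t) ∧ ∃ t ∈ T, (openGraph ω).Reachable t s)) ∧ ∃ s ∈ S, (openGraph ω).Reachable s z ∨ ((∃ t ∈ T, (openGraph ω).Reachable s t) ∧ ∃ t ∈ T, (openGraph ω).Reachable t z)))).card ∧ (A.filter fun z => ∃ u ∈ S, (((openGraph ω).Reachable u z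 ∨ ((∃ t ∈ T, (openGraph ω).Reachable u t) ∧ ∃ t ∈ T, (openGraph ω).Reachable t z)) ∨ ((∃ s ∈ S, (openGraph ω).Reachable u s ∨ ((∃ t ∈ T, (openGraph ω).Reachable u t) ∧ ∃ t ∈ T, (openGraph ω).Reachable t s)) ∧ ∃ s ∈ S, (openGraph ω).Reachable s z ∨ ((∃ t ∈ T, (openGraph ω).Reachable s t) ∧ ∃ t ∈ T, (openGraph ω).Reachable t z)))).card ≤ j} =
      (prodBernoulli K).real {ω : BondConfig (Fin n) | (A.filter fun z => (((openGraph ω).Reachable rS z ∨ ((∃ t ∈ T, (openGraph ω).Reachable rS t) ∧ ∃ t ∈ T, (openGraph ω).Reachable t z)) ∨ ((∃ s ∈ S, (openGraph ω).Reachable rS s ∨ ((∃ t ∈ T, (openGraph ω).Reachable rS t) ∧ ∃ t ∈ T, (openGraph ω).Reachable t s)) ∧ ∃ s ∈ S, (openGraph ω).Reachable s z ∨ ((∃ t ∈ T, (openGraph ω).Reachable s t) ∧ ∃ t ∈ T, (openGraph ω).Reachable t z)))).card ≤ j} := by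
    congr 1
    ext ω
    simp only [mem_setOf_eq]
    rw [Finset.filter_congr (fun z _ => reachClosure_rootS_iff (fun a b => (openGraph ω).Reachable a b)
      (fun a => SimpleGraph.Reachable.refl a) (htr ω) T S hrS z)]
    constructor
    · rintro ⟨_, h⟩; exact h
    · intro h
      refine ⟨Finset.card_pos.2 ⟨rS, Finset.mem_filter.2 ⟨hSA hrS, Or.inl (Or.inl (SimpleGraph.Reachable.refl _))⟩⟩, h⟩
  -- the merged block term is the root lightness of `rT` in the one-block closure
  have hE2 : (prodBernoulli K).real {ω : BondConfig (Fin n) | 1 ≤ (A.filter fun z => ∃ s ∈ T ∪ S, ((openGraph ω).Reachable s z ∨ ((∃ t ∈ T ∪ S, (openGraph ω).Reachable s t) ∧ ∃ t ∈ T ∪ S, (openGraph ω).Reachable t z))).card ∧ (A.filter fun z => ∃ s ∈ T ∪ S, ((openGraph ω).Reachable s z ∨ ((∃ t ∈ T ∪ S, (openGraph ω).Reachable s t) ∧ ∃ t ∈ T ∪ S, (openGraph ω).Reachable t z))).card ≤ j} =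
      (prodBernoulli K).real {ω : BondConfig (Fin n) | (A.filter fun z => (openGraph ω).Reachable rT z ∨ ((∃ t ∈ T ∪ S, (openGraph ω).Reachable rT t) ∧ ∃ t ∈ T ∪ S, (openGraph ω).Reachable t z)).card ≤ j} := by
    congr 1
    ext ω
    simp only [mem_setOf_eq]
    rw [Finset.filter_congr (fun z _ => reachClosure_rootOne_iff (fun a b => (openGraph ω).Reachable a b)
      (fun a => SimpleGraph.Reachable.refl a) (htr ω) (T ∪ S) (Finset.mem_union_left S hrT) z)]
    constructor
    · rintro ⟨_, h⟩; exact h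
    · intro h
      refine ⟨Finset.card_pos.2 ⟨rT, Finset.mem_filter.2 ⟨hTA hrT, Or.inl (SimpleGraph.Reachable.refl _)⟩⟩, h⟩
  rw [hU, l1, hE2, hor i, hor x, hLT, hLS]
  have hmax : max ((prodBernoulli K).real {ω : BondConfig (Fin n) | (A.filter fun z => (((openGraph ω).Reachable rT z ∨ ((∃ t ∈ T, (openGraph ω).Reachable rT t) ∧ ∃ t ∈ T, (openGraph ω).Reachable t z)) ∨ ((∃ s ∈ S, (openGraph ω).Reachable rT s ∨ ((∃ t ∈ T, (openGraph ω).Reachable rT t) ∧ ∃ t ∈ T, (openGraph ω).Reachable t s)) ∧ ∃ s ∈ S, (openGraph ω).Reachable s z ∨ ((∃ t ∈ T, (openGraph ω).Reachable s t) ∧ ∃ t ∈ T, (openGraph ω).Reachable t z)))).card ≤ j})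
        ((prodBernoulli K).real {ω : BondConfig (Fin n) | (A.filter fun z => (((openGraph ω).Reachable rS z ∨ ((∃ t ∈ T, (openGraph ω).Reachable rS t) ∧ ∃ t ∈ T, (openGraph ω).Reachable t z)) ∨ ((∃ s ∈ S, (openGraph ω).Reachable rS s ∨ ((∃ t ∈ T, (openGraph ω).Reachable rS t) ∧ ∃ t ∈ T, (openGraph ω).Reachable t s)) ∧ ∃ s ∈ S, (openGraph ω).Reachable s z ∨ ((∃ t ∈ T, (openGraph ω).Reachable s t) ∧ ∃ t ∈ T, (openGraph ω).Reachable t z)))).card ≤ j}) -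
      (prodBernoulli K).real {ω : BondConfig (Fin n) | (A.filter fun z => (((openGraph ω).Reachable x z ∨ ((∃ t ∈ T, (openGraph ω).Reachable x t) ∧ ∃ t ∈ T, (openGraph ω).Reachable t z)) ∨ ((∃ s ∈ S, (openGraph ω).Reachable x s ∨ ((∃ t ∈ T, (openGraph ω).Reachable x t) ∧ ∃ t ∈ T, (openGraph ω).Reachable t s)) ∧ ∃ s ∈ S, (openGraph ω).Reachable s z ∨ ((∃ t ∈ T, (openGraph ω).Reachable s t) ∧ ∃ t ∈ T, (openGraph ω).Reachable t z)))).card ≤ j} ≤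
      max 0 (max ((prodBernoulli K).real {ω : BondConfig (Fin n) | (A.filter fun z => (((openGraph ω).Reachable rT z ∨ ((∃ t ∈ T, (openGraph ω).Reachable rT t) ∧ ∃ t ∈ T, (openGraph ω).Reachable t z)) ∨ ((∃ s ∈ S, (openGraph ω).Reachable rT s ∨ ((∃ t ∈ T, (openGraph ω).Reachable rT t) ∧ ∃ t ∈ T, (openGraph ω).Reachable t s)) ∧ ∃ s ∈ S, (openGraph ω).Reachable s z ∨ ((∃ t ∈ T, (openGraph ω).Reachable s t) ∧ ∃ t ∈ T, (openGraph ω).Reachable t z)))).card ≤ j})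
        ((prodBernoulli K).real {ω : BondConfig (Fin n) | (A.filter fun z => (((openGraph ω).Reachable rS z ∨ ((∃ t ∈ T, (openGraph ω).Reachable rS t) ∧ ∃ t ∈ T, (openGraph ω).Reachable t z)) ∨ ((∃ s ∈ S, (openGraph ω).Reachable rS s ∨ ((∃ t ∈ T, (openGraph ω).Reachable rS t) ∧ ∃ t ∈ T, (openGraph ω).Reachable t s)) ∧ ∃ s ∈ S, (openGraph ω).Reachable s z ∨ ((∃ t ∈ T, (openGraph ω).Reachable s t) ∧ ∃ t ∈ T, (openGraph ω).Reachable t z)))).card ≤ j}) -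
      (prodBernoulli K).real {ω : BondConfig (Fin n) | (A.filter fun z => (((openGraph ω).Reachable x z ∨ ((∃ t ∈ T, (openGraph ω).Reachable x t) ∧ ∃ t ∈ T, (openGraph ω).Reachable t z)) ∨ ((∃ s ∈ S, (openGraph ω).Reachable x s ∨ ((∃ t ∈ T, (openGraph ω).Reachable x t) ∧ ∃ t ∈ T, (openGraph ω).Reachable t s)) ∧ ∃ s ∈ S, (openGraph ω).Reachable s z ∨ ((∃ t ∈ T, (openGraph ω).Reachable s t) ∧ ∃ t ∈ T, (openGraph ω).Reachable t z)))).card ≤ j}) := le_max_right _ _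
  linarith [cell, hmax]

/-- **Cell with empty first block** (`T = ∅`): no gluing; the cell bound reduces to `ℓ_S − c(x) ≤ max 0 (ℓ_S − c(x))`. [this file] -/
theorem cell_bound_empty_left (K : Sym2 (Fin n) → unitInterval) (A : Finset (Fin n)) (S : Finset (Fin n)) (hSA : S ⊆ A) (i x : Fin n) (j : ℕ) :
    (prodBernoulli K).real {ω : BondConfig (Fin n) | (A.filter fun z => (((openGraph ω).Reachable i z ∨ ((∃ c ∈ (∅ : Finset (Fin n)), (openGraph ω).Reachable c i) ∧ ∃ c' ∈ (∅ : Finset (Fin n)), (openGraph ω).Reachable c' z)) ∨ ((∃ s ∈ S, (openGraph ω).Reachable s i ∨ ((∃ c ∈ (∅ : Finset (Fin n)), (openGraph ω).Reachable c s) ∧ ∃ c' ∈ (∅ : Finset (Fin n)), (openGraph ω).Reachable c' i)) ∧ ∃ s' ∈ S, (openGraph ω).Reachable s' z ∨ ((∃ c ∈ (∅ : Finset (Fin n)), (openGraph ω).Reachable c s') ∧ ∃ c' ∈ (∅ : Finset (Fin n)), (openGraph ω).Reachable c' z)))).card ≤ j} -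
        (prodBernoulli K).real {ω : BondConfig (Fin n) | (A.filter fun z => (((openGraph ω).Reachable x z ∨ ((∃ c ∈ (∅ : Finset (Fin n)), (openGraph ω).Reachable c x) ∧ ∃ c' ∈ (∅ : Finset (Fin n)), (openGraph ω).Reachable c' z)) ∨ ((∃ s ∈ S, (openGraph ω).Reachable s x ∨ ((∃ c ∈ (∅ : Finset (Fin n)), (openGraph ω).Reachable c s) ∧ ∃ c' ∈ (∅ : Finset (Fin n)), (openGraph ω).Reachable c' x)) ∧ ∃ s' ∈ S, (openGraph ω).Reachable s' z ∨ ((∃ c ∈ (∅ : Finset (Fin n)), (openGraph ω).Reachable c s') ∧ ∃ c' ∈ (∅ : Finset (Fin n)), (openGraph ω).Reachable c' z)))).card ≤ j} -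
        max 0 (max ((prodBernoulli K).real {ω : BondConfig (Fin n) | 1 ≤ (A.filter fun z => ∃ u ∈ (∅ : Finset (Fin n)), (((openGraph ω).Reachable u z ∨ ((∃ t ∈ (∅ : Finset (Fin n)), (openGraph ω).Reachable u t) ∧ ∃ t ∈ (∅ : Finset (Fin n)), (openGraph ω).Reachable t z)) ∨ ((∃ s ∈ S, (openGraph ω).Reachable u s ∨ ((∃ t ∈ (∅ : Finset (Fin n)), (openGraph ω).Reachable u t) ∧ ∃ t ∈ (∅ : Finset (Fin n)), (openGraph ω).Reachable t s)) ∧ ∃ s ∈ S, (openGraph ω).Reachable s z ∨ ((∃ t ∈ (∅ : Finset (Fin n)), (openGraph ω).Reachable s t) ∧ ∃ t ∈ (∅ : Finset (Fin n)), (openGraph ω).Reachable t z)))).card ∧ (A.filter fun z => ∃ u ∈ (∅ : Finset (Fin n)), (((openGraph ω).Reachable u z ∨ ((∃ t ∈ (∅ : Finset (Fin n)), (openGraph ω).Reachable u t) ∧ ∃ t ∈ (∅ : Finset (Fin n)), (openGraph ω).Reachable t z)) ∨ ((∃ s ∈ S, (openGraph ω).Reachable u s ∨ ((∃ t ∈ (∅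 : Finset (Fin n)), (openGraph ω).Reachable u t) ∧ ∃ t ∈ (∅ : Finset (Fin n)), (openGraph ω).Reachable t s)) ∧ ∃ s ∈ S, (openGraph ω).Reachable s z ∨ ((∃ t ∈ (∅ : Finset (Fin n)), (openGraph ω).Reachable s t) ∧ ∃ t ∈ (∅ : Finset (Fin n)), (openGraph ω).Reachable t z)))).card ≤ j})
            ((prodBernoulli K).real {ω : BondConfig (Fin n) | 1 ≤ (A.filter fun z => ∃ u ∈ S, (((openGraph ω).Reachable u z ∨ ((∃ t ∈ (∅ : Finset (Fin n)), (openGraph ω).Reachable u t) ∧ ∃ t ∈ (∅ : Finset (Fin n)), (openGraph ω).Reachable t z)) ∨ ((∃ s ∈ S, (openGraph ω).Reachable u s ∨ ((∃ t ∈ (∅ : Finset (Fin n)), (openGraph ω).Reachable u t) ∧ ∃ t ∈ (∅ : Finset (Fin n)), (openGraph ω).Reachable t s)) ∧ ∃ s ∈ S, (openGraph ω).Reachable s z ∨ ((∃ t ∈ (∅ : Finset (Fin n)), (openGraph ω).Reachable s t) ∧ ∃ t ∈ (∅ : Finset (Fin n)), (openGraph ω).Reachable t z)))).card ∧ (A.filter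 fun z => ∃ u ∈ S, (((openGraph ω).Reachable u z ∨ ((∃ t ∈ (∅ : Finset (Fin n)), (openGraph ω).Reachable u t) ∧ ∃ t ∈ (∅ : Finset (Fin n)), (openGraph ω).Reachable t z)) ∨ ((∃ s ∈ S, (openGraph ω).Reachable u s ∨ ((∃ t ∈ (∅ : Finset (Fin n)), (openGraph ω).Reachable u t) ∧ ∃ t ∈ (∅ : Finset (Fin n)), (openGraph ω).Reachable t s)) ∧ ∃ s ∈ S, (openGraph ω).Reachable s z ∨ ((∃ t ∈ (∅ : Finset (Fin n)), (openGraph ω).Reachable s t) ∧ ∃ t ∈ (∅ : Finset (Fin n)), (openGraph ω).Reachable t z)))).card ≤ j}) -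
          (prodBernoulli K).real {ω : BondConfig (Fin n) | (A.filter fun z => (((openGraph ω).Reachable x z ∨ ((∃ c ∈ (∅ : Finset (Fin n)), (openGraph ω).Reachable c x) ∧ ∃ c' ∈ (∅ : Finset (Fin n)), (openGraph ω).Reachable c' z)) ∨ ((∃ s ∈ S, (openGraph ω).Reachable s x ∨ ((∃ c ∈ (∅ : Finset (Fin n)), (openGraph ω).Reachable c s) ∧ ∃ c' ∈ (∅ : Finset (Fin n)), (openGraph ω).Reachable c' x)) ∧ ∃ s' ∈ S, (openGraph ω).Reachable s' z ∨ ((∃ c ∈ (∅ : Finset (Fin n)), (openGraph ω).Reachable c s') ∧ ∃ c' ∈ (∅ : Finset (Fin n)), (openGraph ω).Reachable c' z)))).card ≤ j}) ≤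
      (prodBernoulli K).real {ω : BondConfig (Fin n) | (∀ y ∈ S ∪ (∅ : Finset (Fin n)), ¬ (openGraph ω).Reachable i y) ∧ (A.filter fun z => (openGraph ω).Reachable i z).card ≤ j} -
        (prodBernoulli K).real {ω : BondConfig (Fin n) | (∀ y ∈ S ∪ (∅ : Finset (Fin n)), ¬ (openGraph ω).Reachable i y) ∧ 1 ≤ (A.filter fun z => ∃ y ∈ S ∪ (∅ : Finset (Fin n)), (openGraph ω).Reachable y z).card ∧ (A.filter fun z => ∃ y ∈ S ∪ (∅ : Finset (Fin n)), (openGraph ω).Reachable y z).card ≤ j} := by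
  have hsymm : ∀ (ω : BondConfig (Fin n)) (a b : Fin n), (openGraph ω).Reachable a b → (openGraph ω).Reachable b a :=
    fun ω a b h => h.symm
  have l1 := sepMargin_eq_closure_sub_uniform K A S i j hSA
  have hU : S ∪ (∅ : Finset (Fin n)) = S := Finset.union_empty S
  -- the two-block cells with an empty block are one-block closure lightnesses through `S`
  have hor : ∀ v : Fin n, (prodBernoulli K).real {ω : BondConfig (Fin n) | (A.filter fun z => (((openGraph ω).Reachable v z ∨ ((∃ c ∈ (∅ : Finset (Fin n)), (openGraph ω).Reachable c v) ∧ ∃ c' ∈ (∅ : Finset (Fin n)), (openGraph ω).Reachable c' z)) ∨ ((∃ s ∈ S, (openGraph ω).Reachable s v ∨ ((∃ c ∈ (∅ : Finset (Fin n)), (openGraph ω).Reachable c s) ∧ ∃ c' ∈ (∅ : Finset (Fin n)), (openGraph ω).Reachable c' v)) ∧ ∃ s' ∈ S, (openGraph ω).Reachable s' z ∨ ((∃ c ∈ (∅ : Finset (Fin n)), (openGraph ω).Reachable c s') ∧ ∃ c' ∈ (∅ : Finset (Fin n)), (openGraph ω).Reachable c' z)))).card ≤ j} =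
      (prodBernoulli K).real {ω : BondConfig (Fin n) | (A.filter fun z => (openGraph ω).Reachable v z ∨ ((∃ t ∈ S, (openGraph ω).Reachable v t) ∧ ∃ t ∈ S, (openGraph ω).Reachable t z)).card ≤ j} := by
    intro v
    congr 1
    ext ω
    simp only [mem_setOf_eq]
    have hPQ : (A.filter fun z => (((openGraph ω).Reachable v z ∨ ((∃ c ∈ (∅ : Finset (Fin n)), (openGraph ω).Reachable c v) ∧ ∃ c' ∈ (∅ : Finset (Fin n)), (openGraph ω).Reachable c' z)) ∨ ((∃ s ∈ S, (openGraph ω).Reachable s v ∨ ((∃ c ∈ (∅ : Finset (Fin n)), (openGraph ω).Reachable c s) ∧ ∃ c' ∈ (∅ : Finset (Fin n)), (openGraph ω).Reachable c' v)) ∧ ∃ s' ∈ S, (openGraph ω).Reachable s' z ∨ ((∃ c ∈ (∅ : Finset (Fin n)), (openGraph ω).Reachable c s') ∧ ∃ c' ∈ (∅ : Finset (Fin n)), (openGraph ω).Reachable c' z)))) = (A.filter fun z => ((openGraph ω).Reachable v z ∨ ((∃ t ∈ S, (openGraph ω).Reachable v t) ∧ ∃ t ∈ S, (openGraph ω).Reachable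 t z))) := by
      refine Finset.filter_congr (fun z _ => ?_)
      constructor
      · rintro ((h | ⟨⟨c, hc, _⟩, _⟩) | ⟨⟨s, hs, hsv⟩, ⟨s', hs', hs'z⟩⟩)
        · exact Or.inl h
        · exact absurd hc (Finset.notMem_empty c)
        · refine Or.inr ⟨⟨s, hs, ?_⟩, ⟨s', hs', ?_⟩⟩
          · rcases hsv with h | ⟨⟨c, hc, _⟩, _⟩
            · exact hsymm ω _ _ h
            · exact absurd hc (Finset.notMem_empty c)
          · rcases hs'z with h | ⟨⟨c, hc, _⟩, _⟩
            · exact h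
            · exact absurd hc (Finset.notMem_empty c)
      · rintro (h | ⟨⟨t, ht, hvt⟩, ⟨t', ht', ht'z⟩⟩)
        · exact Or.inl (Or.inl h)
        · exact Or.inr ⟨⟨t, ht, Or.inl (hsymm ω _ _ hvt)⟩, ⟨t', ht', Or.inl ht'z⟩⟩
    rw [hPQ]
  have hL0 : (prodBernoulli K).real {ω : BondConfig (Fin n) | 1 ≤ (A.filter fun z => ∃ u ∈ (∅ : Finset (Fin n)), (((openGraph ω).Reachable u z ∨ ((∃ t ∈ (∅ : Finset (Fin n)), (openGraph ω).Reachable u t) ∧ ∃ t ∈ (∅ : Finset (Fin n)), (openGraph ω).Reachable t z)) ∨ ((∃ s ∈ S, (openGraph ω).Reachable u s ∨ ((∃ t ∈ (∅ : Finset (Fin n)), (openGraph ω).Reachable u t) ∧ ∃ t ∈ (∅ : Finset (Fin n)), (openGraph ω).Reachable t s)) ∧ ∃ s ∈ S, (openGraph ω).Reachable s z ∨ ((∃ t ∈ (∅ : Finset (Fin n)), (openGraph ω).Reachable s t) ∧ ∃ t ∈ (∅ : Finset (Fin n)), (openGraph ω).Reachable t z)))).card ∧ (A.filter fun z => ∃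 u ∈ (∅ : Finset (Fin n)), (((openGraph ω).Reachable u z ∨ ((∃ t ∈ (∅ : Finset (Fin n)), (openGraph ω).Reachable u t) ∧ ∃ t ∈ (∅ : Finset (Fin n)), (openGraph ω).Reachable t z)) ∨ ((∃ s ∈ S, (openGraph ω).Reachable u s ∨ ((∃ t ∈ (∅ : Finset (Fin n)), (openGraph ω).Reachable u t) ∧ ∃ t ∈ (∅ : Finset (Fin n)), (openGraph ω).Reachable t s)) ∧ ∃ s ∈ S, (openGraph ω).Reachable s z ∨ ((∃ t ∈ (∅ : Finset (Fin n)), (openGraph ω).Reachable s t) ∧ ∃ t ∈ (∅ : Finset (Fin n)), (openGraph ω).Reachable t z)))).card ≤ j} = 0 := by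
    have hset : {ω : BondConfig (Fin n) | 1 ≤ (A.filter fun z => ∃ u ∈ (∅ : Finset (Fin n)), (((openGraph ω).Reachable u z ∨ ((∃ t ∈ (∅ : Finset (Fin n)), (openGraph ω).Reachable u t) ∧ ∃ t ∈ (∅ : Finset (Fin n)), (openGraph ω).Reachable t z)) ∨ ((∃ s ∈ S, (openGraph ω).Reachable u s ∨ ((∃ t ∈ (∅ : Finset (Fin n)), (openGraph ω).Reachable u t) ∧ ∃ t ∈ (∅ : Finset (Fin n)), (openGraph ω).Reachable t s)) ∧ ∃ s ∈ S, (openGraph ω).Reachable s z ∨ ((∃ t ∈ (∅ : Finset (Fin n)), (openGraph ω).Reachable s t) ∧ ∃ t ∈ (∅ : Finset (Fin n)), (openGraph ω).Reachable t z)))).card ∧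
        (A.filter fun z => ∃ u ∈ (∅ : Finset (Fin n)), (((openGraph ω).Reachable u z ∨ ((∃ t ∈ (∅ : Finset (Fin n)), (openGraph ω).Reachable u t) ∧ ∃ t ∈ (∅ : Finset (Fin n)), (openGraph ω).Reachable t z)) ∨ ((∃ s ∈ S, (openGraph ω).Reachable u s ∨ ((∃ t ∈ (∅ : Finset (Fin n)), (openGraph ω).Reachable u t) ∧ ∃ t ∈ (∅ : Finset (Fin n)), (openGraph ω).Reachable t s)) ∧ ∃ s ∈ S, (openGraph ω).Reachable s z ∨ ((∃ t ∈ (∅ : Finset (Fin n)), (openGraph ω).Reachable s t) ∧ ∃ t ∈ (∅ : Finset (Fin n)), (openGraph ω).Reachable t z)))).card ≤ j} = ∅ := by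
      ext ω
      simp only [mem_setOf_eq, mem_empty_iff_false, iff_false, not_and]
      intro h1
      exfalso
      obtain ⟨z, hz⟩ := Finset.card_pos.1 h1
      obtain ⟨u, hu, _⟩ := (Finset.mem_filter.1 hz).2
      exact Finset.notMem_empty u hu
    rw [hset, measureReal_empty]
  have hLS : (prodBernoulli K).real {ω : BondConfig (Fin n) | 1 ≤ (A.filter fun z => ∃ u ∈ S, (((openGraph ω).Reachable u z ∨ ((∃ t ∈ (∅ : Finset (Fin n)), (openGraph ω).Reachable u t) ∧ ∃ t ∈ (∅ : Finset (Fin n)), (openGraph ω).Reachable t z)) ∨ ((∃ s ∈ S, (openGraph ω).Reachable u s ∨ ((∃ t ∈ (∅ : Finset (Fin n)), (openGraph ω).Reachable u t) ∧ ∃ t ∈ (∅ : Finset (Fin n)), (openGraph ω).Reachable t s)) ∧ ∃ s ∈ S, (openGraph ω).Reachable s z ∨ ((∃ t ∈ (∅ : Finset (Fin n)), (openGraph ω).Reachable s t) ∧ ∃ t ∈ (∅ : Finset (Fin n)), (openGraph ω).Reachable t z)))).card ∧ (A.filter fun z => ∃ u ∈ S, (((openGraph ω).Reachable u z ∨ ((∃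 t ∈ (∅ : Finset (Fin n)), (openGraph ω).Reachable u t) ∧ ∃ t ∈ (∅ : Finset (Fin n)), (openGraph ω).Reachable t z)) ∨ ((∃ s ∈ S, (openGraph ω).Reachable u s ∨ ((∃ t ∈ (∅ : Finset (Fin n)), (openGraph ω).Reachable u t) ∧ ∃ t ∈ (∅ : Finset (Fin n)), (openGraph ω).Reachable t s)) ∧ ∃ s ∈ S, (openGraph ω).Reachable s z ∨ ((∃ t ∈ (∅ : Finset (Fin n)), (openGraph ω).Reachable s t) ∧ ∃ t ∈ (∅ : Finset (Fin n)), (openGraph ω).Reachable t z)))).card ≤ j} =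
      (prodBernoulli K).real {ω : BondConfig (Fin n) | 1 ≤ (A.filter fun z => ∃ s ∈ S, ((openGraph ω).Reachable s z ∨ ((∃ t ∈ S, (openGraph ω).Reachable s t) ∧ ∃ t ∈ S, (openGraph ω).Reachable t z))).card ∧ (A.filter fun z => ∃ s ∈ S, ((openGraph ω).Reachable s z ∨ ((∃ t ∈ S, (openGraph ω).Reachable s t) ∧ ∃ t ∈ S, (openGraph ω).Reachable t z))).card ≤ j} := by
    congr 1
    ext ω
    simp only [mem_setOf_eq]
    have hPQ : (A.filter fun z => (∃ u ∈ S, (((openGraph ω).Reachable u z ∨ ((∃ t ∈ (∅ : Finset (Fin n)), (openGraph ω).Reachable u t) ∧ ∃ t ∈ (∅ : Finset (Fin n)), (openGraph ω).Reachable t z)) ∨ ((∃ s ∈ S, (openGraph ω).Reachable u s ∨ ((∃ t ∈ (∅ : Finset (Fin n)), (openGraph ω).Reachable u t) ∧ ∃ t ∈ (∅ : Finset (Fin n)), (openGraph ω).Reachable t s)) ∧ ∃ s ∈ S, (openGraph ω).Reachable s z ∨ ((∃ t ∈ (∅ : Finset (Fin n)), (openGraph ω).Reachable s t) ∧ ∃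 t ∈ (∅ : Finset (Fin n)), (openGraph ω).Reachable t z))))) = (A.filter fun z => (∃ s ∈ S, ((openGraph ω).Reachable s z ∨ ((∃ t ∈ S, (openGraph ω).Reachable s t) ∧ ∃ t ∈ S, (openGraph ω).Reachable t z)))) := by
      refine Finset.filter_congr (fun z _ => ?_)
      constructor
      · rintro ⟨u, hu, (h | ⟨⟨c, hc, _⟩, _⟩) | ⟨⟨s, hs, hus⟩, ⟨s', hs', hs'z⟩⟩⟩
        · exact ⟨u, hu, Or.inl h⟩
        · exact absurd hc (Finset.notMem_empty c)
        · refine ⟨u, hu, Or.inr ⟨⟨s, hs, ?_⟩, ⟨s', hs', ?_⟩⟩⟩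
          · rcases hus with h | ⟨⟨c, hc, _⟩, _⟩
            · exact h
            · exact absurd hc (Finset.notMem_empty c)
          · rcases hs'z with h | ⟨⟨c, hc, _⟩, _⟩
            · exact h
            · exact absurd hc (Finset.notMem_empty c)
      · rintro ⟨u, hu, h | ⟨⟨t, ht, hut⟩, ⟨t', ht', ht'z⟩⟩⟩
        · exact ⟨u, hu, Or.inl (Or.inl h)⟩
        · exact ⟨u, hu, Or.inr ⟨⟨t, ht, Or.inl hut⟩, ⟨t', ht', Or.inl ht'z⟩⟩⟩
    rw [hPQ]
  rw [hU, l1, hor i, hor x, hL0, hLS]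
  have h0 : (0 : ℝ) ≤ (prodBernoulli K).real {ω : BondConfig (Fin n) | 1 ≤ (A.filter fun z => ∃ s ∈ S, ((openGraph ω).Reachable s z ∨ ((∃ t ∈ S, (openGraph ω).Reachable s t) ∧ ∃ t ∈ S, (openGraph ω).Reachable t z))).card ∧ (A.filter fun z => ∃ s ∈ S, ((openGraph ω).Reachable s z ∨ ((∃ t ∈ S, (openGraph ω).Reachable s t) ∧ ∃ t ∈ S, (openGraph ω).Reachable t z))).card ≤ j} := measureReal_nonneg
  have hm : max (0 : ℝ) ((prodBernoulli K).real {ω : BondConfig (Fin n) | 1 ≤ (A.filter fun z => ∃ s ∈ S, ((openGraph ω).Reachable s z ∨ ((∃ t ∈ S, (openGraph ω).Reachable s t) ∧ ∃ t ∈ S, (openGraph ω).Reachable t z))).card ∧ (A.filter fun z => ∃ s ∈ S, ((openGraph ω).Reachable s z ∨ ((∃ t ∈ S, (openGraph ω).Reachable s t) ∧ ∃ t ∈ S, (openGraph ω).Reachable t z))).card ≤ j}) = (prodBernoulli K).real {ω : BondConfig (Fin n) | 1 ≤ (A.filter fun z => ∃ s ∈ S, ((openGraph ω).Reachable s z ∨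 ((∃ t ∈ S, (openGraph ω).Reachable s t) ∧ ∃ t ∈ S, (openGraph ω).Reachable t z))).card ∧ (A.filter fun z => ∃ s ∈ S, ((openGraph ω).Reachable s z ∨ ((∃ t ∈ S, (openGraph ω).Reachable s t) ∧ ∃ t ∈ S, (openGraph ω).Reachable t z))).card ≤ j} := max_eq_right h0
  rw [hm]
  have hmax : (prodBernoulli K).real {ω : BondConfig (Fin n) | 1 ≤ (A.filter fun z => ∃ s ∈ S, ((openGraph ω).Reachable s z ∨ ((∃ t ∈ S, (openGraph ω).Reachable s t) ∧ ∃ t ∈ S, (openGraph ω).Reachable t z))).card ∧ (A.filter fun z => ∃ s ∈ S, ((openGraph ω).Reachable s z ∨ ((∃ t ∈ S, (openGraph ω).Reachable s t) ∧ ∃ t ∈ S, (openGraph ω).Reachable t z))).card ≤ j} - (prodBernoulli K).real {ω : BondConfig (Fin n) | (A.filter fun z => (openGraph ω).Reachable x z ∨ ((∃ t ∈ S, (openGraph ω).Reachable x t) ∧ ∃ t ∈ S, (openGraph ω).Reachable t z)).card ≤ j} ≤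
      max 0 ((prodBernoulli K).real {ω : BondConfig (Fin n) | 1 ≤ (A.filter fun z => ∃ s ∈ S, ((openGraph ω).Reachable s z ∨ ((∃ t ∈ S, (openGraph ω).Reachable s t) ∧ ∃ t ∈ S, (openGraph ω).Reachable t z))).card ∧ (A.filter fun z => ∃ s ∈ S, ((openGraph ω).Reachable s z ∨ ((∃ t ∈ S, (openGraph ω).Reachable s t) ∧ ∃ t ∈ S, (openGraph ω).Reachable t z))).card ≤ j} - (prodBernoulli K).real {ω : BondConfig (Fin n) | (A.filter fun z => (openGraph ω).Reachable x z ∨ ((∃ t ∈ S, (openGraph ω).Reachable x t) ∧ ∃ t ∈ S, (openGraph ω).Reachable t z)).card ≤ j}) := le_max_right _ _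
  linarith [hmax]

/-- **Cell with empty second block** (`S = ∅`): no gluing. [this file] -/
theorem cell_bound_empty_right (K : Sym2 (Fin n) → unitInterval) (A : Finset (Fin n)) (T : Finset (Fin n)) (hTA : T ⊆ A) (i x : Fin n) (j : ℕ) :
    (prodBernoulli K).real {ω : BondConfig (Fin n) | (A.filter fun z => (((openGraph ω).Reachable i z ∨ ((∃ c ∈ T, (openGraph ω).Reachable c i) ∧ ∃ c' ∈ T, (openGraph ω).Reachable c' z)) ∨ ((∃ s ∈ (∅ : Finset (Fin n)), (openGraph ω).Reachable s i ∨ ((∃ c ∈ T, (openGraph ω).Reachable c s) ∧ ∃ c' ∈ T, (openGraph ω).Reachable c' i)) ∧ ∃ s' ∈ (∅ : Finset (Fin n)), (openGraph ω).Reachable s' z ∨ ((∃ c ∈ T, (openGraph ω).Reachable c s') ∧ ∃ c' ∈ T, (openGraph ω).Reachable c' z)))).card ≤ j} -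
        (prodBernoulli K).real {ω : BondConfig (Fin n) | (A.filter fun z => (((openGraph ω).Reachable x z ∨ ((∃ c ∈ T, (openGraph ω).Reachable c x) ∧ ∃ c' ∈ T, (openGraph ω).Reachable c' z)) ∨ ((∃ s ∈ (∅ : Finset (Fin n)), (openGraph ω).Reachable s x ∨ ((∃ c ∈ T, (openGraph ω).Reachable c s) ∧ ∃ c' ∈ T, (openGraph ω).Reachable c' x)) ∧ ∃ s' ∈ (∅ : Finset (Fin n)), (openGraph ω).Reachable s' z ∨ ((∃ c ∈ T, (openGraph ω).Reachable c s') ∧ ∃ c' ∈ T, (openGraph ω).Reachable c' z)))).card ≤ j} -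
        max 0 (max ((prodBernoulli K).real {ω : BondConfig (Fin n) | 1 ≤ (A.filter fun z => ∃ u ∈ T, (((openGraph ω).Reachable u z ∨ ((∃ t ∈ T, (openGraph ω).Reachable u t) ∧ ∃ t ∈ T, (openGraph ω).Reachable t z)) ∨ ((∃ s ∈ (∅ : Finset (Fin n)), (openGraph ω).Reachable u s ∨ ((∃ t ∈ T, (openGraph ω).Reachable u t) ∧ ∃ t ∈ T, (openGraph ω).Reachable t s)) ∧ ∃ s ∈ (∅ : Finset (Fin n)), (openGraph ω).Reachable s z ∨ ((∃ t ∈ T, (openGraph ω).Reachable s t) ∧ ∃ t ∈ T, (openGraph ω).Reachable t z)))).card ∧ (A.filter fun z => ∃ u ∈ T, (((openGraph ω).Reachable u z ∨ ((∃ t ∈ T, (openGraph ω).Reachable u t) ∧ ∃ t ∈ T, (openGraph ω).Reachable t z)) ∨ ((∃ s ∈ (∅ : Finset (Fin n)), (openGraph ω).Reachable u s ∨ ((∃ t ∈ T, (openGraph ω).Reachable u t) ∧ ∃ t ∈ T, (openGraph ω).Reachable t s)) ∧ ∃ s ∈ (∅ : Finset (Fin n)), (openGraph ω).Reachable s z ∨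 ((∃ t ∈ T, (openGraph ω).Reachable s t) ∧ ∃ t ∈ T, (openGraph ω).Reachable t z)))).card ≤ j})
            ((prodBernoulli K).real {ω : BondConfig (Fin n) | 1 ≤ (A.filter fun z => ∃ u ∈ (∅ : Finset (Fin n)), (((openGraph ω).Reachable u z ∨ ((∃ t ∈ T, (openGraph ω).Reachable u t) ∧ ∃ t ∈ T, (openGraph ω).Reachable t z)) ∨ ((∃ s ∈ (∅ : Finset (Fin n)), (openGraph ω).Reachable u s ∨ ((∃ t ∈ T, (openGraph ω).Reachable u t) ∧ ∃ t ∈ T, (openGraph ω).Reachable t s)) ∧ ∃ s ∈ (∅ : Finset (Fin n)), (openGraph ω).Reachable s z ∨ ((∃ t ∈ T, (openGraph ω).Reachable s t) ∧ ∃ t ∈ T, (openGraph ω).Reachable t z)))).card ∧ (A.filter fun z => ∃ u ∈ (∅ : Finset (Fin n)), (((openGraph ω).Reachable u z ∨ ((∃ t ∈ T, (openGraph ω).Reachable u t) ∧ ∃ t ∈ T, (openGraph ω).Reachable t z)) ∨ ((∃ s ∈ (∅ : Finset (Fin n)), (openGraph ω).Reachable u s ∨ ((∃ t ∈ T, (openGraph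 ω).Reachable u t) ∧ ∃ t ∈ T, (openGraph ω).Reachable t s)) ∧ ∃ s ∈ (∅ : Finset (Fin n)), (openGraph ω).Reachable s z ∨ ((∃ t ∈ T, (openGraph ω).Reachable s t) ∧ ∃ t ∈ T, (openGraph ω).Reachable t z)))).card ≤ j}) -
          (prodBernoulli K).real {ω : BondConfig (Fin n) | (A.filter fun z => (((openGraph ω).Reachable x z ∨ ((∃ c ∈ T, (openGraph ω).Reachable c x) ∧ ∃ c' ∈ T, (openGraph ω).Reachable c' z)) ∨ ((∃ s ∈ (∅ : Finset (Fin n)), (openGraph ω).Reachable s x ∨ ((∃ c ∈ T, (openGraph ω).Reachable c s) ∧ ∃ c' ∈ T, (openGraph ω).Reachable c' x)) ∧ ∃ s' ∈ (∅ : Finset (Fin n)), (openGraph ω).Reachable s' z ∨ ((∃ c ∈ T, (openGraph ω).Reachable c s') ∧ ∃ c' ∈ T, (openGraph ω).Reachable c' z)))).card ≤ j}) ≤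
      (prodBernoulli K).real {ω : BondConfig (Fin n) | (∀ y ∈ (∅ : Finset (Fin n)) ∪ T, ¬ (openGraph ω).Reachable i y) ∧ (A.filter fun z => (openGraph ω).Reachable i z).card ≤ j} -
        (prodBernoulli K).real {ω : BondConfig (Fin n) | (∀ y ∈ (∅ : Finset (Fin n)) ∪ T, ¬ (openGraph ω).Reachable i y) ∧ 1 ≤ (A.filter fun z => ∃ y ∈ (∅ : Finset (Fin n)) ∪ T, (openGraph ω).Reachable y z).card ∧ (A.filter fun z => ∃ y ∈ (∅ : Finset (Fin n)) ∪ T, (openGraph ω).Reachable y z).card ≤ j} := by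
  have hsymm : ∀ (ω : BondConfig (Fin n)) (a b : Fin n), (openGraph ω).Reachable a b → (openGraph ω).Reachable b a :=
    fun ω a b h => h.symm
  have l1 := sepMargin_eq_closure_sub_uniform K A T i j hTA
  have hU : (∅ : Finset (Fin n)) ∪ T = T := Finset.empty_union T
  have hor : ∀ v : Fin n, (prodBernoulli K).real {ω : BondConfig (Fin n) | (A.filter fun z => (((openGraph ω).Reachable v z ∨ ((∃ c ∈ T, (openGraph ω).Reachable c v) ∧ ∃ c' ∈ T, (openGraph ω).Reachable c' z)) ∨ ((∃ s ∈ (∅ : Finset (Fin n)), (openGraph ω).Reachable s v ∨ ((∃ c ∈ T, (openGraph ω).Reachable c s) ∧ ∃ c' ∈ T, (openGraph ω).Reachable c' v)) ∧ ∃ s' ∈ (∅ : Finset (Fin n)), (openGraph ω).Reachable s' z ∨ ((∃ c ∈ T, (openGraph ω).Reachable c s') ∧ ∃ c' ∈ T, (openGraph ω).Reachable c' z)))).card ≤ j} =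
      (prodBernoulli K).real {ω : BondConfig (Fin n) | (A.filter fun z => (openGraph ω).Reachable v z ∨ ((∃ t ∈ T, (openGraph ω).Reachable v t) ∧ ∃ t ∈ T, (openGraph ω).Reachable t z)).card ≤ j} := by
    intro v
    congr 1
    ext ω
    simp only [mem_setOf_eq]
    have hPQ : (A.filter fun z => (((openGraph ω).Reachable v z ∨ ((∃ c ∈ T, (openGraph ω).Reachable c v) ∧ ∃ c' ∈ T, (openGraph ω).Reachable c' z)) ∨ ((∃ s ∈ (∅ : Finset (Fin n)), (openGraph ω).Reachable s v ∨ ((∃ c ∈ T, (openGraph ω).Reachable c s) ∧ ∃ c' ∈ T, (openGraph ω).Reachable c' v)) ∧ ∃ s' ∈ (∅ : Finset (Fin n)), (openGraph ω).Reachable s' z ∨ ((∃ c ∈ T, (openGraph ω).Reachable c s') ∧ ∃ c' ∈ T, (openGraph ω).Reachable c' z)))) = (A.filter fun z => ((openGraph ω).Reachable v z ∨ ((∃ t ∈ T, (openGraph ω).Reachable v t) ∧ ∃ t ∈ T, (openGraph ω).Reachable t z))) := by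
      refine Finset.filter_congr (fun z _ => ?_)
      constructor
      · rintro ((h | ⟨⟨c, hc, hcv⟩, ⟨c', hc', hc'z⟩⟩) | ⟨⟨s, hs, _⟩, _⟩)
        · exact Or.inl h
        · exact Or.inr ⟨⟨c, hc, hsymm ω _ _ hcv⟩, ⟨c', hc', hc'z⟩⟩
        · exact absurd hs (Finset.notMem_empty s)
      · rintro (h | ⟨⟨t, ht, hvt⟩, ⟨t', ht', ht'z⟩⟩)
        · exact Or.inl (Or.inl h)
        · exact Or.inl (Or.inr ⟨⟨t, ht, hsymm ω _ _ hvt⟩, ⟨t', ht', ht'z⟩⟩)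
    rw [hPQ]
  have hLT : (prodBernoulli K).real {ω : BondConfig (Fin n) | 1 ≤ (A.filter fun z => ∃ u ∈ T, (((openGraph ω).Reachable u z ∨ ((∃ t ∈ T, (openGraph ω).Reachable u t) ∧ ∃ t ∈ T, (openGraph ω).Reachable t z)) ∨ ((∃ s ∈ (∅ : Finset (Fin n)), (openGraph ω).Reachable u s ∨ ((∃ t ∈ T, (openGraph ω).Reachable u t) ∧ ∃ t ∈ T, (openGraph ω).Reachable t s)) ∧ ∃ s ∈ (∅ : Finset (Fin n)), (openGraph ω).Reachable s z ∨ ((∃ t ∈ T, (openGraph ω).Reachable s t) ∧ ∃ t ∈ T, (openGraph ω).Reachable t z)))).card ∧ (A.filter fun z => ∃ u ∈ T, (((openGraph ω).Reachable u z ∨ ((∃ t ∈ T, (openGraph ω).Reachable u t) ∧ ∃ t ∈ T, (openGraph ω).Reachable t z)) ∨ ((∃ s ∈ (∅ : Finset (Fin n)), (openGraph ω).Reachable u s ∨ ((∃ t ∈ T, (openGraph ω).Reachable u t) ∧ ∃ t ∈ T, (openGraph ω).Reachable t s)) ∧ ∃ s ∈ (∅ : Finset (Fin n)), (openGraph ω).Reachable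 s z ∨ ((∃ t ∈ T, (openGraph ω).Reachable s t) ∧ ∃ t ∈ T, (openGraph ω).Reachable t z)))).card ≤ j} =
      (prodBernoulli K).real {ω : BondConfig (Fin n) | 1 ≤ (A.filter fun z => ∃ s ∈ T, ((openGraph ω).Reachable s z ∨ ((∃ t ∈ T, (openGraph ω).Reachable s t) ∧ ∃ t ∈ T, (openGraph ω).Reachable t z))).card ∧ (A.filter fun z => ∃ s ∈ T, ((openGraph ω).Reachable s z ∨ ((∃ t ∈ T, (openGraph ω).Reachable s t) ∧ ∃ t ∈ T, (openGraph ω).Reachable t z))).card ≤ j} := by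
    congr 1
    ext ω
    simp only [mem_setOf_eq]
    have hPQ : (A.filter fun z => (∃ u ∈ T, (((openGraph ω).Reachable u z ∨ ((∃ t ∈ T, (openGraph ω).Reachable u t) ∧ ∃ t ∈ T, (openGraph ω).Reachable t z)) ∨ ((∃ s ∈ (∅ : Finset (Fin n)), (openGraph ω).Reachable u s ∨ ((∃ t ∈ T, (openGraph ω).Reachable u t) ∧ ∃ t ∈ T, (openGraph ω).Reachable t s)) ∧ ∃ s ∈ (∅ : Finset (Fin n)), (openGraph ω).Reachable s z ∨ ((∃ t ∈ T, (openGraph ω).Reachable s t) ∧ ∃ t ∈ T, (openGraph ω).Reachable t z))))) = (A.filter fun z => (∃ s ∈ T, ((openGraph ω).Reachable s z ∨ ((∃ t ∈ T, (openGraph ω).Reachable s t) ∧ ∃ t ∈ T, (openGraph ω).Reachable t z)))) := by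
      refine Finset.filter_congr (fun z _ => ?_)
      constructor
      · rintro ⟨u, hu, (h | ⟨⟨t, ht, hut⟩, ⟨t', ht', ht'z⟩⟩) | ⟨⟨s, hs, _⟩, _⟩⟩
        · exact ⟨u, hu, Or.inl h⟩
        · exact ⟨u, hu, Or.inr ⟨⟨t, ht, hut⟩, ⟨t', ht', ht'z⟩⟩⟩
        · exact absurd hs (Finset.notMem_empty s)
      · rintro ⟨u, hu, h | ⟨⟨t, ht, hut⟩, ⟨t', ht', ht'z⟩⟩⟩
        · exact ⟨u, hu, Or.inl (Or.inl h)⟩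
        · exact ⟨u, hu, Or.inl (Or.inr ⟨⟨t, ht, hut⟩, ⟨t', ht', ht'z⟩⟩)⟩
    rw [hPQ]
  have hL0 : (prodBernoulli K).real {ω : BondConfig (Fin n) | 1 ≤ (A.filter fun z => ∃ u ∈ (∅ : Finset (Fin n)), (((openGraph ω).Reachable u z ∨ ((∃ t ∈ T, (openGraph ω).Reachable u t) ∧ ∃ t ∈ T, (openGraph ω).Reachable t z)) ∨ ((∃ s ∈ (∅ : Finset (Fin n)), (openGraph ω).Reachable u s ∨ ((∃ t ∈ T, (openGraph ω).Reachable u t) ∧ ∃ t ∈ T, (openGraph ω).Reachable t s)) ∧ ∃ s ∈ (∅ : Finset (Fin n)), (openGraph ω).Reachable s z ∨ ((∃ t ∈ T, (openGraph ω).Reachable s t) ∧ ∃ t ∈ T, (openGraph ω).Reachable t z)))).card ∧ (A.filter fun z => ∃ u ∈ (∅ : Finset (Fin n)), (((openGraph ω).Reachable u z ∨ ((∃ t ∈ T, (openGraph ω).Reachable u t) ∧ ∃ t ∈ T, (openGraph ω).Reachable t z)) ∨ ((∃ s ∈ (∅ : Finset (Fin n)), (openGraph ω).Reachable u s ∨ ((∃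 t ∈ T, (openGraph ω).Reachable u t) ∧ ∃ t ∈ T, (openGraph ω).Reachable t s)) ∧ ∃ s ∈ (∅ : Finset (Fin n)), (openGraph ω).Reachable s z ∨ ((∃ t ∈ T, (openGraph ω).Reachable s t) ∧ ∃ t ∈ T, (openGraph ω).Reachable t z)))).card ≤ j} = 0 := by
    have hset : {ω : BondConfig (Fin n) | 1 ≤ (A.filter fun z => ∃ u ∈ (∅ : Finset (Fin n)), (((openGraph ω).Reachable u z ∨ ((∃ t ∈ T, (openGraph ω).Reachable u t) ∧ ∃ t ∈ T, (openGraph ω).Reachable t z)) ∨ ((∃ s ∈ (∅ : Finset (Fin n)), (openGraph ω).Reachable u s ∨ ((∃ t ∈ T, (openGraph ω).Reachable u t) ∧ ∃ t ∈ T, (openGraph ω).Reachable t s)) ∧ ∃ s ∈ (∅ : Finset (Fin n)), (openGraph ω).Reachable s z ∨ ((∃ t ∈ T, (openGraph ω).Reachable s t) ∧ ∃ t ∈ T, (openGraph ω).Reachable t z)))).card ∧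
        (A.filter fun z => ∃ u ∈ (∅ : Finset (Fin n)), (((openGraph ω).Reachable u z ∨ ((∃ t ∈ T, (openGraph ω).Reachable u t) ∧ ∃ t ∈ T, (openGraph ω).Reachable t z)) ∨ ((∃ s ∈ (∅ : Finset (Fin n)), (openGraph ω).Reachable u s ∨ ((∃ t ∈ T, (openGraph ω).Reachable u t) ∧ ∃ t ∈ T, (openGraph ω).Reachable t s)) ∧ ∃ s ∈ (∅ : Finset (Fin n)), (openGraph ω).Reachable s z ∨ ((∃ t ∈ T, (openGraph ω).Reachable s t) ∧ ∃ t ∈ T, (openGraph ω).Reachable t z)))).card ≤ j} = ∅ := by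
      ext ω
      simp only [mem_setOf_eq, mem_empty_iff_false, iff_false, not_and]
      intro h1
      exfalso
      obtain ⟨z, hz⟩ := Finset.card_pos.1 h1
      obtain ⟨u, hu, _⟩ := (Finset.mem_filter.1 hz).2
      exact Finset.notMem_empty u hu
    rw [hset, measureReal_empty]
  rw [hU, l1, hor i, hor x, hLT, hL0]
  have h0 : (0 : ℝ) ≤ (prodBernoulli K).real {ω : BondConfig (Fin n) | 1 ≤ (A.filter fun z => ∃ s ∈ T, ((openGraph ω).Reachable s z ∨ ((∃ t ∈ T, (openGraph ω).Reachable s t) ∧ ∃ t ∈ T, (openGraph ω).Reachable t z))).card ∧ (A.filter fun z => ∃ s ∈ T, ((openGraph ω).Reachable s z ∨ ((∃ t ∈ T, (openGraph ω).Reachable s t) ∧ ∃ t ∈ T, (openGraph ω).Reachable t z))).card ≤ j} := measureReal_nonneg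
  have hm : max ((prodBernoulli K).real {ω : BondConfig (Fin n) | 1 ≤ (A.filter fun z => ∃ s ∈ T, ((openGraph ω).Reachable s z ∨ ((∃ t ∈ T, (openGraph ω).Reachable s t) ∧ ∃ t ∈ T, (openGraph ω).Reachable t z))).card ∧ (A.filter fun z => ∃ s ∈ T, ((openGraph ω).Reachable s z ∨ ((∃ t ∈ T, (openGraph ω).Reachable s t) ∧ ∃ t ∈ T, (openGraph ω).Reachable t z))).card ≤ j}) (0 : ℝ) = (prodBernoulli K).real {ω : BondConfig (Fin n) | 1 ≤ (A.filter fun z => ∃ s ∈ T, ((openGraph ω).Reachable s z ∨ ((∃ t ∈ T, (openGraph ω).Reachable s t) ∧ ∃ t ∈ T, (openGraph ω).Reachable t z))).card ∧ (A.filter fun z => ∃ s ∈ T, ((openGraph ω).Reachable s z ∨ ((∃ t ∈ T, (openGraph ω).Reachable s t) ∧ ∃ t ∈ T, (openGraph ω).Reachable t z))).card ≤ j} := max_eq_left h0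
  rw [hm]
  have hmax : (prodBernoulli K).real {ω : BondConfig (Fin n) | 1 ≤ (A.filter fun z => ∃ s ∈ T, ((openGraph ω).Reachable s z ∨ ((∃ t ∈ T, (openGraph ω).Reachable s t) ∧ ∃ t ∈ T, (openGraph ω).Reachable t z))).card ∧ (A.filter fun z => ∃ s ∈ T, ((openGraph ω).Reachable s z ∨ ((∃ t ∈ T, (openGraph ω).Reachable s t) ∧ ∃ t ∈ T, (openGraph ω).Reachable t z))).card ≤ j} - (prodBernoulli K).real {ω : BondConfig (Fin n) | (A.filter fun z => (openGraph ω).Reachable x z ∨ ((∃ t ∈ T, (openGraph ω).Reachable x t) ∧ ∃ t ∈ T, (openGraph ω).Reachable t z)).card ≤ j} ≤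
      max 0 ((prodBernoulli K).real {ω : BondConfig (Fin n) | 1 ≤ (A.filter fun z => ∃ s ∈ T, ((openGraph ω).Reachable s z ∨ ((∃ t ∈ T, (openGraph ω).Reachable s t) ∧ ∃ t ∈ T, (openGraph ω).Reachable t z))).card ∧ (A.filter fun z => ∃ s ∈ T, ((openGraph ω).Reachable s z ∨ ((∃ t ∈ T, (openGraph ω).Reachable s t) ∧ ∃ t ∈ T, (openGraph ω).Reachable t z))).card ≤ j} - (prodBernoulli K).real {ω : BondConfig (Fin n) | (A.filter fun z => (openGraph ω).Reachable x z ∨ ((∃ t ∈ T, (openGraph ω).Reachable x t) ∧ ∃ t ∈ T, (openGraph ω).Reachable t z)).card ≤ j}) := le_max_right _ _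
  linarith [hmax]

/-- **Cell whose blocks share a vertex** (`v ∈ T ∩ S`): the two closures coincide, no gluing. [this file] -/
theorem cell_bound_meet (K : Sym2 (Fin n) → unitInterval) (A : Finset (Fin n)) (T S : Finset (Fin n)) (hTA : T ⊆ A) (hSA : S ⊆ A) {v : Fin n} (hvT : v ∈ T) (hvS : v ∈ S) (i x : Fin n) (j : ℕ) :
    (prodBernoulli K).real {ω : BondConfig (Fin n) | (A.filter fun z => (((openGraph ω).Reachable i z ∨ ((∃ c ∈ T, (openGraph ω).Reachable c i) ∧ ∃ c' ∈ T, (openGraph ω).Reachable c' z)) ∨ ((∃ s ∈ S, (openGraph ω).Reachable s i ∨ ((∃ c ∈ T, (openGraph ω).Reachable c s) ∧ ∃ c' ∈ T, (openGraph ω).Reachable c' i)) ∧ ∃ s' ∈ S, (openGraph ω).Reachable s' z ∨ ((∃ c ∈ T, (openGraph ω).Reachable c s') ∧ ∃ c' ∈ T, (openGraph ω).Reachable c' z)))).card ≤ j} -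
        (prodBernoulli K).real {ω : BondConfig (Fin n) | (A.filter fun z => (((openGraph ω).Reachable x z ∨ ((∃ c ∈ T, (openGraph ω).Reachable c x) ∧ ∃ c' ∈ T, (openGraph ω).Reachable c' z)) ∨ ((∃ s ∈ S, (openGraph ω).Reachable s x ∨ ((∃ c ∈ T, (openGraph ω).Reachable c s) ∧ ∃ c' ∈ T, (openGraph ω).Reachable c' x)) ∧ ∃ s' ∈ S, (openGraph ω).Reachable s' z ∨ ((∃ c ∈ T, (openGraph ω).Reachable c s') ∧ ∃ c' ∈ T, (openGraph ω).Reachable c' z)))).card ≤ j} -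
        max 0 (max ((prodBernoulli K).real {ω : BondConfig (Fin n) | 1 ≤ (A.filter fun z => ∃ u ∈ T, (((openGraph ω).Reachable u z ∨ ((∃ t ∈ T, (openGraph ω).Reachable u t) ∧ ∃ t ∈ T, (openGraph ω).Reachable t z)) ∨ ((∃ s ∈ S, (openGraph ω).Reachable u s ∨ ((∃ t ∈ T, (openGraph ω).Reachable u t) ∧ ∃ t ∈ T, (openGraph ω).Reachable t s)) ∧ ∃ s ∈ S, (openGraph ω).Reachable s z ∨ ((∃ t ∈ T, (openGraph ω).Reachable s t) ∧ ∃ t ∈ T, (openGraph ω).Reachable t z)))).card ∧ (A.filter fun z => ∃ u ∈ T, (((openGraph ω).Reachable u z ∨ ((∃ t ∈ T, (openGraph ω).Reachable u t) ∧ ∃ t ∈ T, (openGraph ω).Reachable t z)) ∨ ((∃ s ∈ S, (openGraph ω).Reachable u s ∨ ((∃ t ∈ T, (openGraph ω).Reachable u t) ∧ ∃ t ∈ T, (openGraph ω).Reachable t s)) ∧ ∃ s ∈ S, (openGraph ω).Reachable s z ∨ ((∃ t ∈ T, (openGraph ω).Reachable s t) ∧ ∃ t ∈ T, (openGraph ω).Reachable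 t z)))).card ≤ j})
            ((prodBernoulli K).real {ω : BondConfig (Fin n) | 1 ≤ (A.filter fun z => ∃ u ∈ S, (((openGraph ω).Reachable u z ∨ ((∃ t ∈ T, (openGraph ω).Reachable u t) ∧ ∃ t ∈ T, (openGraph ω).Reachable t z)) ∨ ((∃ s ∈ S, (openGraph ω).Reachable u s ∨ ((∃ t ∈ T, (openGraph ω).Reachable u t) ∧ ∃ t ∈ T, (openGraph ω).Reachable t s)) ∧ ∃ s ∈ S, (openGraph ω).Reachable s z ∨ ((∃ t ∈ T, (openGraph ω).Reachable s t) ∧ ∃ t ∈ T, (openGraph ω).Reachable t z)))).card ∧ (A.filter fun z => ∃ u ∈ S, (((openGraph ω).Reachable u z ∨ ((∃ t ∈ T, (openGraph ω).Reachable u t) ∧ ∃ t ∈ T, (openGraph ω).Reachable t z)) ∨ ((∃ s ∈ S, (openGraph ω).Reachable u s ∨ ((∃ t ∈ T, (openGraph ω).Reachable u t) ∧ ∃ t ∈ T, (openGraph ω).Reachable t s)) ∧ ∃ s ∈ S, (openGraph ω).Reachable s z ∨ ((∃ t ∈ T, (openGraph ω).Reachable s t) ∧ ∃ t ∈ T,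 (openGraph ω).Reachable t z)))).card ≤ j}) -
          (prodBernoulli K).real {ω : BondConfig (Fin n) | (A.filter fun z => (((openGraph ω).Reachable x z ∨ ((∃ c ∈ T, (openGraph ω).Reachable c x) ∧ ∃ c' ∈ T, (openGraph ω).Reachable c' z)) ∨ ((∃ s ∈ S, (openGraph ω).Reachable s x ∨ ((∃ c ∈ T, (openGraph ω).Reachable c s) ∧ ∃ c' ∈ T, (openGraph ω).Reachable c' x)) ∧ ∃ s' ∈ S, (openGraph ω).Reachable s' z ∨ ((∃ c ∈ T, (openGraph ω).Reachable c s') ∧ ∃ c' ∈ T, (openGraph ω).Reachable c' z)))).card ≤ j}) ≤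
      (prodBernoulli K).real {ω : BondConfig (Fin n) | (∀ y ∈ S ∪ T, ¬ (openGraph ω).Reachable i y) ∧ (A.filter fun z => (openGraph ω).Reachable i z).card ≤ j} -
        (prodBernoulli K).real {ω : BondConfig (Fin n) | (∀ y ∈ S ∪ T, ¬ (openGraph ω).Reachable i y) ∧ 1 ≤ (A.filter fun z => ∃ y ∈ S ∪ T, (openGraph ω).Reachable y z).card ∧ (A.filter fun z => ∃ y ∈ S ∪ T, (openGraph ω).Reachable y z).card ≤ j} := by
  have hsymm : ∀ (ω : BondConfig (Fin n)) (a b : Fin n), (openGraph ω).Reachable a b → (openGraph ω).Reachable b a :=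
    fun ω a b h => h.symm
  have htr : ∀ (ω : BondConfig (Fin n)) (a b d : Fin n), (openGraph ω).Reachable a b → (openGraph ω).Reachable b d →
      (openGraph ω).Reachable a d := fun ω a b d h1 h2 => h1.trans h2
  have hU : S ∪ T = T ∪ S := Finset.union_comm _ _
  have hvU : v ∈ T ∪ S := Finset.mem_union_left S hvT
  have l1 := sepMargin_eq_closure_sub_uniform K A (T ∪ S) i j (Finset.union_subset hTA hSA)
  -- every two-block cell is the one-block closure lightness through `T ∪ S`
  have hor : ∀ w' : Fin n, (prodBernoulli K).real {ω : BondConfig (Fin n) | (A.filter fun z => (((openGraph ω).Reachable w' z ∨ ((∃ c ∈ T, (openGraph ω).Reachable c w') ∧ ∃ c' ∈ T, (openGraph ω).Reachable c' z)) ∨ ((∃ s ∈ S, (openGraph ω).Reachable s w' ∨ ((∃ c ∈ T, (openGraph ω).Reachable c s) ∧ ∃ c' ∈ T, (openGraph ω).Reachable c' w')) ∧ ∃ s' ∈ S, (openGraph ω).Reachable s' z ∨ ((∃ c ∈ T, (openGraph ω).Reachable c s') ∧ ∃ c' ∈ T, (openGraph ω).Reachable c' z)))).card ≤ j} =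
      (prodBernoulli K).real {ω : BondConfig (Fin n) | (A.filter fun z => (openGraph ω).Reachable w' z ∨ ((∃ t ∈ T ∪ S, (openGraph ω).Reachable w' t) ∧ ∃ t ∈ T ∪ S, (openGraph ω).Reachable t z)).card ≤ j} := by
    intro w'
    congr 1
    ext ω
    simp only [mem_setOf_eq]
    rw [Finset.filter_congr (s := A) (fun z _ => (twoBlock_orient_iff (fun a b => (openGraph ω).Reachable a b) (hsymm ω) T S w' z).trans
      (twoBlock_iff_oneBlock_of_meet (fun a b => (openGraph ω).Reachable a b) (fun a => SimpleGraph.Reachable.refl a) T S hvT hvS w' z))]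
  -- both block terms are the merged block term
  have hblk : ∀ (B : Finset (Fin n)), v ∈ B → B ⊆ T ∪ S →
      (prodBernoulli K).real {ω : BondConfig (Fin n) | 1 ≤ (A.filter fun z => ∃ u ∈ B, (((openGraph ω).Reachable u z ∨ ((∃ t ∈ T, (openGraph ω).Reachable u t) ∧ ∃ t ∈ T, (openGraph ω).Reachable t z)) ∨ ((∃ s ∈ S, (openGraph ω).Reachable u s ∨ ((∃ t ∈ T, (openGraph ω).Reachable u t) ∧ ∃ t ∈ T, (openGraph ω).Reachable t s)) ∧ ∃ s ∈ S, (openGraph ω).Reachable s z ∨ ((∃ t ∈ T, (openGraph ω).Reachable s t) ∧ ∃ t ∈ T, (openGraph ω).Reachable t z)))).card ∧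
        (A.filter fun z => ∃ u ∈ B, (((openGraph ω).Reachable u z ∨ ((∃ t ∈ T, (openGraph ω).Reachable u t) ∧ ∃ t ∈ T, (openGraph ω).Reachable t z)) ∨ ((∃ s ∈ S, (openGraph ω).Reachable u s ∨ ((∃ t ∈ T, (openGraph ω).Reachable u t) ∧ ∃ t ∈ T, (openGraph ω).Reachable t s)) ∧ ∃ s ∈ S, (openGraph ω).Reachable s z ∨ ((∃ t ∈ T, (openGraph ω).Reachable s t) ∧ ∃ t ∈ T, (openGraph ω).Reachable t z)))).card ≤ j} =
      (prodBernoulli K).real {ω : BondConfig (Fin n) | 1 ≤ (A.filter fun z => ∃ s ∈ T ∪ S, ((openGraph ω).Reachable s z ∨ ((∃ t ∈ T ∪ S, (openGraph ω).Reachable s t) ∧ ∃ t ∈ T ∪ S, (openGraph ω).Reachable t z))).card ∧ (A.filter fun z => ∃ s ∈ T ∪ S, ((openGraph ω).Reachable s z ∨ ((∃ t ∈ T ∪ S, (openGraph ω).Reachable s t) ∧ ∃ t ∈ T ∪ S, (openGraph ω).Reachable t z))).card ≤ j} := by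
    intro B hvB hBU
    congr 1
    ext ω
    simp only [mem_setOf_eq]
    have hPQ : (A.filter fun z => (∃ u ∈ B, (((openGraph ω).Reachable u z ∨ ((∃ t ∈ T, (openGraph ω).Reachable u t) ∧ ∃ t ∈ T, (openGraph ω).Reachable t z)) ∨ ((∃ s ∈ S, (openGraph ω).Reachable u s ∨ ((∃ t ∈ T, (openGraph ω).Reachable u t) ∧ ∃ t ∈ T, (openGraph ω).Reachable t s)) ∧ ∃ s ∈ S, (openGraph ω).Reachable s z ∨ ((∃ t ∈ T, (openGraph ω).Reachable s t) ∧ ∃ t ∈ T, (openGraph ω).Reachable t z))))) = (A.filter fun z => (∃ s ∈ T ∪ S, ((openGraph ω).Reachable s z ∨ ((∃ t ∈ T ∪ S, (openGraph ω).Reachable s t) ∧ ∃ t ∈ T ∪ S, (openGraph ω).Reachable t z)))) := by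
      refine Finset.filter_congr (fun z _ => ?_)
      constructor
      · rintro ⟨u, hu, h⟩
        exact ⟨u, hBU hu, oneBlock_of_twoBlock _ T S u z h⟩
      · rintro ⟨s, hs, h⟩
        refine ⟨v, hvB, (twoBlock_iff_oneBlock_of_meet (fun a b => (openGraph ω).Reachable a b)
          (fun a => SimpleGraph.Reachable.refl a) T S hvT hvS v z).2 ?_⟩
        have hvs : (openGraph ω).Reachable v s ∨ ((∃ t ∈ T ∪ S, (openGraph ω).Reachable v t) ∧ ∃ t ∈ T ∪ S, (openGraph ω).Reachable t s) :=
          Or.inr ⟨⟨v, hvU, SimpleGraph.Reachable.refl _⟩, ⟨s, hs, SimpleGraph.Reachable.refl _⟩⟩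
        exact reachClosure_transitive _ (htr ω) (T ∪ S) v s z hvs h
    rw [hPQ]
  rw [hU, l1, hor i, hor x, hblk T hvT Finset.subset_union_left, hblk S hvS Finset.subset_union_right, max_self]
  have hmax : (prodBernoulli K).real {ω : BondConfig (Fin n) | 1 ≤ (A.filter fun z => ∃ s ∈ T ∪ S, ((openGraph ω).Reachable s z ∨ ((∃ t ∈ T ∪ S, (openGraph ω).Reachable s t) ∧ ∃ t ∈ T ∪ S, (openGraph ω).Reachable t z))).card ∧ (A.filter fun z => ∃ s ∈ T ∪ S, ((openGraph ω).Reachable s z ∨ ((∃ t ∈ T ∪ S, (openGraph ω).Reachable s t) ∧ ∃ t ∈ T ∪ S, (openGraph ω).Reachable t z))).card ≤ j} - (prodBernoulli K).real {ω : BondConfig (Fin n) | (A.filter fun z => (openGraph ω).Reachable x z ∨ ((∃ t ∈ T ∪ S, (openGraph ω).Reachable x t) ∧ ∃ t ∈ T ∪ S, (openGraph ω).Reachable t z)).card ≤ j} ≤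
      max 0 ((prodBernoulli K).real {ω : BondConfig (Fin n) | 1 ≤ (A.filter fun z => ∃ s ∈ T ∪ S, ((openGraph ω).Reachable s z ∨ ((∃ t ∈ T ∪ S, (openGraph ω).Reachable s t) ∧ ∃ t ∈ T ∪ S, (openGraph ω).Reachable t z))).card ∧ (A.filter fun z => ∃ s ∈ T ∪ S, ((openGraph ω).Reachable s z ∨ ((∃ t ∈ T ∪ S, (openGraph ω).Reachable s t) ∧ ∃ t ∈ T ∪ S, (openGraph ω).Reachable t z))).card ≤ j} - (prodBernoulli K).real {ω : BondConfig (Fin n) | (A.filter fun z => (openGraph ω).Reachable x z ∨ ((∃ t ∈ T ∪ S, (openGraph ω).Reachable x t) ∧ ∃ t ∈ T ∪ S, (openGraph ω).Reachable t z)).card ≤ j}) := le_max_right _ _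
  linarith [hmax]


end Hyperedge

end Summit.CriticalPhenomena.PercolationContinuityZ3.Theorems
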